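import Mathlib
import Literature.Probability.LatticeModels.TemperleyLiebBaxterization
import Literature.Probability.Percolation.DiagonalColumnPatterns
import Literature.Probability.Percolation.DiagonalStripTransferInhomogeneous
import Literature.Probability.Percolation.DiagonalStripTLAction
import Literature.Probability.Percolation.DiagonalStripLumping
import Literature.Probability.Percolation.DiagonalStripStationary
import Literature.Probability.Percolation.DiagonalStripGenericRapidities
import Literature.Probability.Percolation.DiagonalStripGenericSwap
import Literature.Probability.Percolation.DiagonalStripGenericPropagation
import Literature.Probability.Percolation.DiagonalStripGenericInversion
import HarnessLib

/-!
# Ikhlef–Ponsaing's boundary qKZ system (generic setting) and its stability under `t(w; z⃗)`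

Topic `Literature/Probability/Percolation`. Ikhlef–Ponsaing (J. Stat. Phys. 149 (2012),
arXiv:1202.5476) §3.4: the ground state of the double-row transfer matrix satisfies the boundary
qKZ system `Ř_i(z_i/z_{i+1}) Ψ = π_i Ψ`, `Ψ(1/z_1, …) = Ψ`, `Ψ(…, 1/z_L) = Ψ`. Here the system is a
predicate **`IsIPqKZSolution m q ψ`** on vectors `ψ : ColPattern m → Frac K₀[X]` (exchange
equations in the kernel convention of Lemma 3.2 with `π_i = genSwap i`, reflections `genInv 1`,
`genInv (2m+1)`, support on valid even patterns), and the theorem proved is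
**`IsIPqKZSolution.transfer`**: if `ψ` is a solution then so is `t(w; z⃗)ψ`, with the same component
sum — from Lemma 3.2 (interlacing + reflections) alone, no commutation of transfer matrices and no
genericity hypotheses beyond `q² + q + 1 = 0` in `K₀`. What turns this into "the ground state IS the
qKZ solution" (IP12's use) is a uniqueness theorem for the system (de Gier–Pyatov 2007), not here.

## References

* Y. Ikhlef, A. K. Ponsaing, J. Stat. Phys. 149 (2012) 10–36, arXiv:1202.5476, §3.4.
  [IkhlefPonsaing2012]
-/

namespace Literature.Probability.Percolation

open Literature.Probability.LatticeModels

variable {m : ℕ}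

/-! ### Ikhlef–Ponsaing's boundary qKZ system in the generic setting -/

section GenericQKZ

open Literature.Probability.LatticeModels.TemperleyLieb

variable {K₀ : Type*} [Field K₀]

/-- **IP12's boundary qKZ system** (§3.4: `Ř_i(z_i/z_{i+1}) Ψ = π_i Ψ` for `1 ≤ i ≤ 2m`,
`Ψ(1/z_1, …) = Ψ`, `Ψ(…, 1/z_L) = Ψ`) for a vector `ψ : ColPattern m → Frac K₀[X]` of rational
functions supported on valid even patterns, in the kernel convention of
`DiagonalStripTransferInterlacingTwoRow.lean` (`e_{2j+1} = join_{j,j+1}`, `e_{2b} = iso_b`, `≡` up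
to lumping, `π_i = genSwap i`, reflections `= genInv 1, genInv L`):
`[q z_{i+1}/z_i] ψ(Q) - [z_i/z_{i+1}] Σ_{e_i Q₀ ≡ Q} ψ(Q₀) = [q z_i/z_{i+1}] σ_i(ψ(Q))`.
[cite: IkhlefPonsaing2012, §3.4] -/
structure IsIPqKZSolution (m : ℕ) (q : K₀) (ψ : ColPattern m → RapidityField K₀) : Prop where
  support : ∀ Q, ψ Q ≠ 0 → IsValid 0 Q
  exch_odd : ∀ (j j1 : Fin (m + 1)), (j1 : ℕ) = j + 1 → ∀ Q,
    qbr (genC K₀ q * genZ K₀ (2 * j + 2) / genZ K₀ (2 * j + 1)) * ψ Q -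
        qbr (genZ K₀ (2 * j + 1) / genZ K₀ (2 * j + 2)) *
          ∑ Q₀ ∈ Finset.univ.filter (fun Q₀ => lump (cpJoin j j1 Q₀) = Q), ψ Q₀ =
      qbr (genC K₀ q * genZ K₀ (2 * j + 1) / genZ K₀ (2 * j + 2)) * genSwap K₀ (2 * j + 1) (ψ Q)
  exch_even : ∀ (b0 b : Fin (m + 1)), (b : ℕ) = b0 + 1 → ∀ Q,
    qbr (genC K₀ q * genZ K₀ (2 * b + 1) / genZ K₀ (2 * b)) * ψ Q -
        qbr (genZ K₀ (2 * b) / genZ K₀ (2 * b + 1)) *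
          ∑ Q₀ ∈ Finset.univ.filter (fun Q₀ => lump (cpIsolate b Q₀) = Q), ψ Q₀ =
      qbr (genC K₀ q * genZ K₀ (2 * b) / genZ K₀ (2 * b + 1)) * genSwap K₀ (2 * b) (ψ Q)
  refl_bot : ∀ Q, genInv K₀ 1 (ψ Q) = ψ Q
  refl_top : ∀ Q, genInv K₀ (2 * m + 1) (ψ Q) = ψ Q

/-- Validity does not depend on the column beyond its parity. [folklore] -/
theorem isValid_zero_of_isValid_two {P : ColPattern m} (h : IsValid 2 P) : IsValid 0 P :=
  ⟨h.refl, h.symm, h.trans, h.wall, fun _ => h.bottom (by norm_num)⟩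

/-- **`t(w; z⃗)` maps solutions of IP12's boundary qKZ system to solutions** (generic setting, only
`q² + q + 1 = 0` assumed): with `Φ(Q'') = Σ_Q t(w; z⃗)(Q → Q'') ψ(Q)`, if `ψ` solves the system so
does `Φ`, and `Σ Φ = Σ ψ`. This is the transfer-matrix half of IP12 §3.4 ("the interlacing
relations yield the qKZ equation for the ground state"): combined with a uniqueness theorem for the
system it identifies the ground state of `t` with the qKZ solution. [cite: IkhlefPonsaing2012, §3.4] -/
theorem IsIPqKZSolution.transfer {q : K₀} (hq : q ^ 2 + q + 1 = 0) {ψ : ColPattern m → RapidityField K₀}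
    (hψ : IsIPqKZSolution m q ψ) :
    IsIPqKZSolution m q (fun Q'' => ∑ Q, ipTransferMatrixW m (genC K₀ q) (genW K₀) (genZ K₀) Q Q'' * ψ Q) ∧
      ∑ Q'', ∑ Q, ipTransferMatrixW m (genC K₀ q) (genW K₀) (genZ K₀) Q Q'' * ψ Q = ∑ Q, ψ Q := by
  refine ⟨⟨fun Q'' h => ?_, fun j j1 hj1 Q'' => ?_, fun b0 b hb0 Q'' => ?_, fun Q'' => ?_, fun Q'' => ?_⟩,
    sum_ipTransferMatrixW_apply_generic q ψ⟩
  · -- support: a pattern reached by `t` is the lumping of a valid pattern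
    obtain ⟨Q, -, hQ⟩ := Finset.exists_ne_zero_of_sum_ne_zero h
    have ht : ipTransferMatrixW m (genC K₀ q) (genW K₀) (genZ K₀) Q Q'' ≠ 0 := left_ne_zero_of_mul hQ
    rw [ipTransferMatrixW_eq] at ht
    obtain ⟨P₁, -, hP₁⟩ := Finset.exists_ne_zero_of_sum_ne_zero ht
    obtain ⟨P₂, hP₂, hP₂'⟩ := Finset.exists_ne_zero_of_sum_ne_zero hP₁
    have hv := isValid_of_ipTransferW_ne_zero (right_ne_zero_of_mul hP₂')
    rw [← (Finset.mem_filter.1 hP₂).2]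
    exact isValid_zero_of_isValid_two (by simpa using lump_isValid hv)
  · exact genSwap_exchange_propagate_odd hq j j1 hj1 hψ.support (hψ.exch_odd j j1 hj1) Q''
  · exact genSwap_exchange_propagate_even hq b0 b hb0 hψ.support (hψ.exch_even b0 b hb0) Q''
  · -- bottom reflection
    rw [map_sum]
    refine Finset.sum_congr rfl fun Q _ => ?_
    by_cases hQ : ψ Q = 0
    · simp [hQ]
    · rw [map_mul, hψ.refl_bot, genInv_ipTransferMatrixW_bottom q ((hψ.support Q hQ).bottom (by norm_num))]
  · -- top reflection
    rw [map_sum]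
    refine Finset.sum_congr rfl fun Q _ => ?_
    rw [map_mul, hψ.refl_top, genInv_ipTransferMatrixW_top]

end GenericQKZ

end Literature.Probability.Percolation
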